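import Mathlib.Analysis.Convex.Slope
import Literature.MathematicalPhysics.QuantumLattice.HubbardTorus2DEnergyDensityConvex
import HarnessLib

/-!
# Crux `CwSsbToEvenTorusLRO` (stmt-HubbardSuperconductivity-10439, route `ChiralWindow`), line
`griffiths-block-slope` — the canonical ground-state energy density of the 2D Hubbard torus for an
interaction of EITHER sign (support towards stub `stub_canonicalSupportingPotential` = item
stmt-HubbardSuperconductivity-9491 `CanonicalSupportingPotential`)

The tree's `Literature/…/HubbardTorus2DEnergyDensity(Convex).lean` proves, for `U ≥ 0` only, that
the canonical ground-state energy per site `E_{L×L}(N_L(n))/L²` (`N_L(n) = rectN n L = 2⌊nL²/2⌋`) of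
the Hubbard tori `ℤ/Lℤ × ℤ/Lℤ` converges to `energyDensity2D t U n` and that the limit is convex in
`n ∈ [0, 2)`. The sign of `U` enters only through the a priori bounds
`-8|t|ab ≤ E_{a×b}(N) ≤ (8|t| + U)ab`; here the argument is redone with the sign-free bounds
`|E_{a×b}(N)| ≤ (8|t| + |U|)ab` (`0 ≤ ⟨n_{x↑}n_{x↓}⟩ ≤ 1`), giving for EVERY real `U` the limit
(`csp_tendsto_energyDensity2D`: Fekete along squares fed by the row tiling
`groundEnergyAt_rows_div_le` and the complement filling), the one-sided Lipschitz bound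
(`csp_energyDensity2D_le_add`) and convexity on `[0, 2)` (`csp_convexOn_energyDensity2D`); the
main theorem `csp_energyDensity` collects limit and convexity. Ruelle, *Statistical Mechanics*
(1969) §2.2, §3.3–3.4. No definition is introduced. [folklore]
-/

noncomputable section

set_option linter.dupNamespace false

namespace Summit.HubbardSuperconductivity.HubbardSuperconductivity.Theorems.CwSsbToEvenTorusLRO

open Literature.MathematicalPhysics.QuantumLattice Matrix Finset Filter Topology
open Literature.MathematicalPhysics.QuantumLattice.ThermodynamicLimit

/-- **Sign-free a priori bounds on the sector energies.** On a graph with at most `P` ordered bonds,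
for every real `U` and every sector `N ≤ 2|Λ|`: `|E_G(N)| ≤ 2|t|P + |U||Λ|` (the hopping sum of a
unit vector is bounded by `2P`, and `0 ≤ Σ_x ⟨n_{x↑} n_{x↓}⟩ ≤ |Λ|`). [folklore] -/
theorem csp_groundEnergyAt_mem_Icc {Λ : Type*} [LinearOrder Λ] [Fintype Λ] (G : SimpleGraph Λ)
    [DecidableRel G.Adj] (t U : ℝ) {P : ℕ} (hP : #{pq : Λ × Λ | G.Adj pq.1 pq.2} ≤ P)
    {N : ℕ} (hN : N ≤ 2 * Fintype.card Λ) :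
    groundEnergyAt G t U N ∈
      Set.Icc (-(2 * |t| * P + |U| * Fintype.card Λ)) (2 * |t| * P + |U| * Fintype.card Λ) := by
  -- adapted from `ThermodynamicLimit.groundEnergyAt_mem_Icc` (HubbardTorus2DTiling.lean)
  have hc : N ≤ Fintype.card (Orb Λ) := by rwa [card_orb]
  have key : ∀ ψ : Fock (Orb Λ), star ψ ⬝ᵥ ψ = 1 → (expect (hamiltonian G t U) ψ).re ∈
      Set.Icc (-(2 * |t| * P + |U| * Fintype.card Λ)) (2 * |t| * P + |U| * Fintype.card Λ) := by
    intro ψ hψ1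
    unfold Literature.MathematicalPhysics.QuantumLattice.expect
    rw [dotProduct_hamiltonian_mulVec, Complex.add_re]
    set A : ℂ := ∑ x, ∑ y, ∑ σ : Fin 2, (if G.Adj x y then
        star (annihilation (orb x σ) *ᵥ ψ) ⬝ᵥ (annihilation (orb y σ) *ᵥ ψ) else 0) with hA
    have hAn : ‖A‖ ≤ 2 * P := norm_hoppingSum_le G hψ1 hP
    have h2 : |(-(t : ℂ) * A).re| ≤ |t| * (2 * P) :=
      ((Complex.abs_re_le_norm _).trans_eq (by rw [norm_mul, norm_neg, Complex.norm_real,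
        Real.norm_eq_abs])).trans (mul_le_mul_of_nonneg_left hAn (abs_nonneg t))
    have h4 := abs_le.1 h2
    set S : ℂ := ∑ x, star ψ ⬝ᵥ (numberOp x 0 *ᵥ (numberOp x 1 *ᵥ ψ)) with hS
    have hS0 : 0 ≤ S.re := by
      rw [hS, Complex.re_sum]
      exact Finset.sum_nonneg fun x _ => re_dotProduct_numberOp_numberOp_nonneg ψ x
    have hS1 : S.re ≤ Fintype.card Λ := by
      rw [hS, Complex.re_sum]
      calc ∑ x, (star ψ ⬝ᵥ (numberOp x 0 *ᵥ (numberOp x 1 *ᵥ ψ))).re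
          ≤ ∑ _x : Λ, (1 : ℝ) := Finset.sum_le_sum fun x _ =>
            (re_dotProduct_numberOp_numberOp_le ψ x).trans (by rw [hψ1, Complex.one_re])
        _ = Fintype.card Λ := by simp
    have hD : |((U : ℂ) * S).re| ≤ |U| * Fintype.card Λ := by
      rw [Complex.re_ofReal_mul, abs_mul, abs_of_nonneg hS0]
      exact mul_le_mul_of_nonneg_left hS1 (abs_nonneg U)
    have hD' := abs_le.1 hD
    constructor <;> linarith [h4.1, h4.2, hD'.1, hD'.2]
  constructor
  · refine le_csInf (groundEnergySet_nonempty _ hc) ?_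
    rintro E ⟨ψ, -, hψ1, rfl⟩
    exact (key ψ hψ1).1
  · obtain ⟨E, ⟨ψ, hψN, hψ1, rfl⟩⟩ := groundEnergySet_nonempty (hamiltonian G t U) hc
    exact (groundEnergy_le_re_expect _ hψN hψ1).trans (key ψ hψ1).2

/-- On `ℤ/aℤ × ℤ/bℤ`, for every real `U`: `-(8|t| + |U|)ab ≤ E(N) ≤ (8|t| + |U|)ab`. [folklore] -/
theorem csp_groundEnergyAt_rect_mem_Icc (a b : ℕ) (t U : ℝ) {N : ℕ} (hN : N ≤ 2 * (a * b)) :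
    groundEnergyAt (fermionRectTorusGraph a b) t U N ∈
      Set.Icc (-((8 * |t| + |U|) * (a * b))) ((8 * |t| + |U|) * (a * b)) := by
  have h := csp_groundEnergyAt_mem_Icc (fermionRectTorusGraph a b) t U
    (card_filter_fermionRectTorusGraph_adj_pair_le a b) (N := N) (by rwa [card_rectSites])
  rw [card_rectSites] at h
  push_cast at h
  constructor <;> nlinarith [h.1, h.2, abs_nonneg t]

/-- **Complement filling, sign-free.** For every real `U`:
`E_{ℓ+r}(N + N_B) ≤ E_ℓ(N) + (8|t| + |U|)((ℓ+r)² − ℓ²) + 8|t|(2ℓ + r)` for any number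
`N_B ≤ 2((ℓ+r)² − ℓ²)` of particles put into the two complementary rectangles. [folklore] -/
theorem csp_groundEnergyAt_square_fill (ℓ r : ℕ) (t U : ℝ) {N NB : ℕ}
    (hN : N ≤ 2 * (ℓ * ℓ)) (hNB : NB ≤ 2 * (r * ℓ + r * (ℓ + r))) :
    groundEnergyAt (fermionRectTorusGraph (ℓ + r) (ℓ + r)) t U (N + NB) ≤
      groundEnergyAt (fermionRectTorusGraph ℓ ℓ) t U N +
        (8 * |t| + |U|) * (r * ℓ + r * (ℓ + r)) + 8 * |t| * (2 * ℓ + r) := by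
  -- adapted from `ThermodynamicLimit.groundEnergyAt_square_fill` (HubbardTorus2DTiling.lean)
  set N₁ : ℕ := min NB (2 * (r * ℓ)) with hN₁
  set N₂ : ℕ := NB - N₁ with hN₂
  have hN₁le : N₁ ≤ 2 * (r * ℓ) := min_le_right _ _
  have hN₁le' : N₁ ≤ NB := min_le_left _ _
  have hNB' : NB = N₁ + N₂ := by omega
  have hN₂le : N₂ ≤ 2 * (r * (ℓ + r)) := by
    rcases le_total NB (2 * (r * ℓ)) with h | h
    · have : N₁ = NB := min_eq_left h
      omega
    · have : N₁ = 2 * (r * ℓ) := min_eq_right h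
      omega
  have hA : N + N₁ ≤ 2 * (ℓ * (ℓ + r)) := by nlinarith
  have hcut1 := groundEnergyAt_rect_cut ℓ r (ℓ + r) t U hA hN₂le
  have hcut2 := groundEnergyAt_rect_cut ℓ r ℓ t U hN hN₁le
  rw [groundEnergyAt_rect_swap] at hcut2
  have hB1 := (csp_groundEnergyAt_rect_mem_Icc r ℓ t U hN₁le).2
  have hB2 := (csp_groundEnergyAt_rect_mem_Icc r (ℓ + r) t U hN₂le).2
  rw [hNB', ← add_assoc]
  push_cast at hcut1 hcut2 hB1 hB2 ⊢
  nlinarith [hcut1, hcut2, hB1, hB2, abs_nonneg t, abs_nonneg U]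

/-- **Thermodynamic limit of the canonical ground-state energy density of the 2D Hubbard torus,
for an interaction of either sign**: for every `t`, every real `U` and `0 ≤ n < 2`,
`E_{L×L}(2⌊nL²/2⌋)/L²` converges (Fekete along squares: the row tiling `groundEnergyAt_rows_div_le`
at equal densities, the sign-free complement filling and a priori bound). [folklore] -/
theorem csp_tendsto_groundEnergyAt_square_div_sq (t U : ℝ) {n : ℝ} (hn0 : 0 ≤ n) (hn2 : n < 2) :
    ∃ e : ℝ, Tendsto (fun L : ℕ =>
      groundEnergyAt (fermionRectTorusGraph L L) t U (rectN n L) / (L : ℝ) ^ 2) atTop (𝓝 e) := by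
  -- adapted from `ThermodynamicLimit.tendsto_groundEnergyAt_square_div_sq`
  set A : ℝ := addCost t U n with hA
  have h2n : 0 < 2 - n := by linarith
  have hA0 : 0 ≤ A := addCost_nonneg t U hn2
  set M₀ : ℕ := ⌈1 / (2 - n)⌉₊ + 1 with hM₀
  have hM₀1 : 1 ≤ M₀ := Nat.le_add_left 1 _
  have hM₀n : 1 / (2 - n) ≤ M₀ := by
    have := Nat.le_ceil (1 / (2 - n))
    simp only [hM₀]; push_cast; linarith
  set b : ℕ → ℝ := fun L => groundEnergyAt (fermionRectTorusGraph L L) t U (rectN n L) / (L : ℝ) ^ 2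
    with hb
  refine tendsto_of_tiling_of_filling b (C := 16 * |t| + |U| + 2 * A) (D := 0) (c := 8 * |t| + |U|)
    hM₀1 (by positivity) le_rfl ?_ ?_ ?_
  · -- a priori lower bound
    intro M hM
    have hM1 : (1 : ℝ) ≤ M := by exact_mod_cast hM₀1.trans hM
    have hE := (csp_groundEnergyAt_rect_mem_Icc M M t U (rectN_le_two_mul hn0 hn2.le M)).1
    simp only [hb]
    rw [le_div_iff₀ (by positivity)]
    nlinarith [abs_nonneg t, abs_nonneg U]
  · -- tiling: the row tiling with all rows at density `n`
    intro k M hM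
    have hM1 : 1 ≤ M := hM₀1.trans hM
    have hMpos : (0 : ℝ) < M := by exact_mod_cast hM1
    have h := groundEnergyAt_rows_div_le t U hn0 hn2 hn0 hn2 k 0 (Nat.zero_le _) hM1
    have hK : ((k + 1 : ℕ) : ℝ) ≠ 0 := by positivity
    simp only [Nat.cast_zero, zero_mul, zero_add, sub_zero, zero_div, mul_div_cancel_left₀ _ hK,
      div_self hK, one_mul] at h
    simp only [hb]
    refine h.trans ?_
    rw [zero_div, add_zero, add_le_add_iff_left]
    exact div_le_div_of_nonneg_right (by linarith [abs_nonneg U]) hMpos.le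
  · -- filling
    intro ℓ L hℓ hℓL
    have hℓ1 : 1 ≤ ℓ := hM₀1.trans hℓ
    have hL1 : 1 ≤ L := hℓ1.trans hℓL
    obtain ⟨r, rfl⟩ : ∃ r, L = ℓ + r := ⟨L - ℓ, by omega⟩
    set NB : ℕ := rectN n (ℓ + r) - rectN n ℓ with hNB
    have hmono := rectN_mono_left hn0 (Nat.le_add_right ℓ r)
    have hsum : rectN n ℓ + NB = rectN n (ℓ + r) := by omega
    have hNBle : NB ≤ 2 * (r * ℓ + r * (ℓ + r)) := by
      rcases Nat.eq_zero_or_pos r with hr | hr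
      · subst hr; simp [hNB]
      · have h1 := rectN_le hn0 (ℓ + r)
        have h2 := lt_rectN_add_two n ℓ
        have hNBr : (NB : ℝ) = rectN n (ℓ + r) - rectN n ℓ := by
          rw [hNB, Nat.cast_sub hmono]
        have hℓr : (1 : ℝ) ≤ r := by exact_mod_cast hr
        have hℓ' : (M₀ : ℝ) ≤ ℓ := by exact_mod_cast hℓ
        have hgap : 2 ≤ (2 - n) * (((ℓ : ℝ) + r) ^ 2 - (ℓ : ℝ) ^ 2) := by
          have h3 : (2 : ℝ) * ℓ + 1 ≤ ((ℓ : ℝ) + r) ^ 2 - (ℓ : ℝ) ^ 2 := by nlinarith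
          have h4 : 1 ≤ (2 - n) * M₀ := by
            rw [div_le_iff₀ h2n] at hM₀n; linarith
          nlinarith
        have key : (NB : ℝ) ≤ 2 * (r * ℓ + r * (ℓ + r) : ℕ) := by
          rw [hNBr]; push_cast at h1 ⊢; nlinarith
        exact_mod_cast key
    have hfill := csp_groundEnergyAt_square_fill ℓ r t U (rectN_le_two_mul hn0 hn2.le ℓ) hNBle
    rw [hsum] at hfill
    simp only [hb]
    have hℓpos : (0 : ℝ) < ℓ := by exact_mod_cast hℓ1
    have hLpos : (0 : ℝ) < ((ℓ + r : ℕ) : ℝ) := by exact_mod_cast hL1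
    rw [mul_div_cancel₀ _ (by positivity), mul_div_cancel₀ _ (by positivity)]
    push_cast at hfill ⊢
    have ht0 : 0 ≤ |t| := abs_nonneg t
    have hU0 : 0 ≤ |U| := abs_nonneg U
    have hr0 : (0 : ℝ) ≤ r := by positivity
    have hG0 : (0 : ℝ) ≤ ((ℓ : ℝ) + r) ^ 2 - (ℓ : ℝ) ^ 2 := by nlinarith
    have hG : (r : ℝ) * ℓ + r * (ℓ + r) = ((ℓ : ℝ) + r) ^ 2 - (ℓ : ℝ) ^ 2 := by ring
    rw [hG] at hfill
    nlinarith [hfill, mul_nonneg ht0 hG0, mul_nonneg hU0 (add_nonneg hℓpos.le hr0),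
      mul_nonneg ht0 hr0, mul_nonneg hA0 hG0, mul_nonneg hA0 (add_nonneg hℓpos.le hr0),
      mul_nonneg hU0 hG0]

/-- The defining limit, for every real `U`: `E_{L×L}(N_L(n))/L² → energyDensity2D t U n` for
`0 ≤ n < 2`. [folklore] -/
theorem csp_tendsto_energyDensity2D (t U : ℝ) {n : ℝ} (hn0 : 0 ≤ n) (hn2 : n < 2) :
    Tendsto (fun L : ℕ => groundEnergyAt (fermionRectTorusGraph L L) t U (rectN n L) / (L : ℝ) ^ 2)
      atTop (𝓝 (energyDensity2D t U n)) :=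
  tendsto_nhds_limUnder (csp_tendsto_groundEnergyAt_square_div_sq t U hn0 hn2)

/-- **One-sided Lipschitz bound (adding density)**, every real `U`: for `0 ≤ y ≤ z < 2`,
`e(z) ≤ e(y) + A(z)(z − y)` with `A = addCost t U`. [folklore] -/
theorem csp_energyDensity2D_le_add (t U : ℝ) {y z : ℝ} (hy : 0 ≤ y) (hyz : y ≤ z) (hz : z < 2) :
    energyDensity2D t U z ≤ energyDensity2D t U y + addCost t U z * (z - y) := by
  -- adapted from `ThermodynamicLimit.energyDensity2D_le_add`
  have hz0 : 0 ≤ z := hy.trans hyz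
  have hy2 : y < 2 := hyz.trans_lt hz
  have hf := csp_tendsto_energyDensity2D t U hz0 hz
  have hA0 := addCost_nonneg t U hz
  have hg : Tendsto (fun L : ℕ => groundEnergyAt (fermionRectTorusGraph L L) t U (rectN y L) /
      (L : ℝ) ^ 2 + addCost t U z * (z - y + (2 : ℝ) / L)) atTop
      (𝓝 (energyDensity2D t U y + addCost t U z * (z - y + 0))) :=
    (csp_tendsto_energyDensity2D t U hy hy2).add (tendsto_const_nhds.mul
      (tendsto_const_nhds.add (tendsto_const_div_atTop_nhds_zero_nat 2)))
  rw [add_zero] at hg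
  refine le_of_tendsto_of_tendsto hf hg (eventually_atTop.2 ⟨1, fun L hL => ?_⟩)
  obtain ⟨d, hd⟩ : ∃ d, rectN z L = rectN y L + d := ⟨rectN z L - rectN y L, by
    have := rectN_mono hyz L; omega⟩
  have hadd := groundEnergyAt_square_add_le L t U hz (N := rectN y L) (d := d)
    (by rw [← hd]; exact rectN_le hz0 L)
  rw [← hd] at hadd
  have hdle : (d : ℝ) ≤ (z - y) * (L : ℝ) ^ 2 + 2 := by
    have h1 := rectN_le hz0 L
    have h2 := lt_rectN_add_two y L
    have : (rectN z L : ℝ) = rectN y L + d := by exact_mod_cast hd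
    nlinarith
  set Ez := groundEnergyAt (fermionRectTorusGraph L L) t U (rectN z L) with hEz
  set Ey := groundEnergyAt (fermionRectTorusGraph L L) t U (rectN y L) with hEy
  show Ez / (L : ℝ) ^ 2 ≤ Ey / (L : ℝ) ^ 2 + addCost t U z * (z - y + 2 / L)
  have hL1 : (1 : ℝ) ≤ L := by exact_mod_cast hL
  have h3 : (d : ℝ) * (36 * (2 * |t| + |U|) / (2 - z)) ≤
      addCost t U z * ((z - y) * (L : ℝ) ^ 2 + 2 * L) := by
    rw [show (36 * (2 * |t| + |U|) / (2 - z)) = addCost t U z from rfl, mul_comm]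
    exact mul_le_mul_of_nonneg_left (by nlinarith) hA0
  have key : Ez ≤ Ey + addCost t U z * ((z - y) * (L : ℝ) ^ 2 + 2 * L) := by linarith
  have hL2 : (0 : ℝ) < (L : ℝ) ^ 2 := by positivity
  have : Ey / (L : ℝ) ^ 2 + addCost t U z * (z - y + 2 / L) =
      (Ey + addCost t U z * ((z - y) * (L : ℝ) ^ 2 + 2 * L)) / (L : ℝ) ^ 2 := by
    field_simp
  rw [this, div_le_div_iff_of_pos_right hL2]
  exact key

/-- **Convexity at rational weights**, every real `U`: for `x, y ∈ [0, 2)`, `K = k + 1`, `a ≤ K`,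
`e((a x + (K−a) y)/K) ≤ (a/K) e(x) + ((K−a)/K) e(y)` (row tiling along `M → ∞`). [folklore] -/
theorem csp_energyDensity2D_ratConvex (t U : ℝ) {x y : ℝ} (hx0 : 0 ≤ x) (hx2 : x < 2) (hy0 : 0 ≤ y)
    (hy2 : y < 2) (k a : ℕ) (ha : a ≤ k + 1) :
    energyDensity2D t U ((a * x + ((k + 1 : ℕ) - a) * y) / (k + 1 : ℕ)) ≤
      (a / (k + 1 : ℕ)) * energyDensity2D t U x +
        (((k + 1 : ℕ) - a) / (k + 1 : ℕ)) * energyDensity2D t U y := by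
  -- adapted from `ThermodynamicLimit.energyDensity2D_ratConvex`
  have hKpos : (0 : ℝ) < (k + 1 : ℕ) := by positivity
  have haK : (a : ℝ) ≤ (k + 1 : ℕ) := by exact_mod_cast ha
  have hKa : (0 : ℝ) ≤ ((k + 1 : ℕ) : ℝ) - a := by linarith
  have hz0 : 0 ≤ (a * x + ((k + 1 : ℕ) - a) * y) / (k + 1 : ℕ) := by
    apply div_nonneg _ hKpos.le
    have : 0 ≤ (((k + 1 : ℕ) : ℝ) - a) * y := mul_nonneg hKa hy0
    positivity
  have hz2 : (a * x + ((k + 1 : ℕ) - a) * y) / (k + 1 : ℕ) < 2 := by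
    rw [div_lt_iff₀ hKpos]
    have h1 : (a : ℝ) * x ≤ a * max x y := mul_le_mul_of_nonneg_left (le_max_left _ _) (by positivity)
    have h2 : (((k + 1 : ℕ) : ℝ) - a) * y ≤ (((k + 1 : ℕ) : ℝ) - a) * max x y :=
      mul_le_mul_of_nonneg_left (le_max_right _ _) hKa
    have : max x y < 2 := max_lt hx2 hy2
    nlinarith
  have hf := (csp_tendsto_energyDensity2D t U hz0 hz2).comp
    (tendsto_atTop_mono (fun M : ℕ => Nat.le_mul_of_pos_left M (Nat.succ_pos k)) tendsto_id)
  have hg : Tendsto (fun M : ℕ => (a / (k + 1 : ℕ)) * (groundEnergyAt (fermionRectTorusGraph M M) t U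
      (rectN x M) / (M : ℝ) ^ 2) + (((k + 1 : ℕ) - a) / (k + 1 : ℕ)) *
      (groundEnergyAt (fermionRectTorusGraph M M) t U (rectN y M) / (M : ℝ) ^ 2) +
      (16 * |t| + 2 * addCost t U ((a * x + ((k + 1 : ℕ) - a) * y) / (k + 1 : ℕ))) / M) atTop
      (𝓝 ((a / (k + 1 : ℕ)) * energyDensity2D t U x +
        (((k + 1 : ℕ) - a) / (k + 1 : ℕ)) * energyDensity2D t U y + 0)) :=
    ((tendsto_const_nhds.mul (csp_tendsto_energyDensity2D t U hx0 hx2)).add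
      (tendsto_const_nhds.mul (csp_tendsto_energyDensity2D t U hy0 hy2))).add
      (tendsto_const_div_atTop_nhds_zero_nat _)
  rw [add_zero] at hg
  refine le_of_tendsto_of_tendsto hf hg (eventually_atTop.2 ⟨1, fun M hM => ?_⟩)
  exact groundEnergyAt_rows_div_le t U hx0 hx2 hy0 hy2 k a ha hM

/-- **Convexity of the ground-state energy density in the density, for an interaction of either
sign**: `n ↦ energyDensity2D t U n` is convex on `[0, 2)` (rational weights by the row tiling, real
weights by approximation from below and the one-sided Lipschitz bound). [folklore] -/
theorem csp_convexOn_energyDensity2D (t U : ℝ) :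
    ConvexOn ℝ (Set.Ico (0 : ℝ) 2) (energyDensity2D t U) := by
  -- adapted from `ThermodynamicLimit.convexOn_energyDensity2D`
  refine ⟨convex_Ico 0 2, ?_⟩
  intro x hx y hy a b ha hb hab
  wlog hxy : x ≤ y generalizing x y a b
  · have h := this hy hx hb ha (by linarith) (le_of_not_ge hxy)
    rw [add_comm] at h
    rw [smul_eq_mul, smul_eq_mul] at *
    linarith [h]
  rw [smul_eq_mul, smul_eq_mul, smul_eq_mul, smul_eq_mul]
  obtain ⟨hx0, hx2⟩ := hx
  obtain ⟨hy0, hy2⟩ := hy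
  set w := a * x + b * y with hw
  have hb1 : b ≤ 1 := by linarith
  have hwx : x ≤ w := by simp only [hw]; nlinarith
  have hwy : w ≤ y := by simp only [hw]; nlinarith
  have hw2 : w < 2 := hwy.trans_lt hy2
  have hw0 : 0 ≤ w := hx0.trans hwx
  set ex := energyDensity2D t U x
  set ey := energyDensity2D t U y
  set C : ℝ := |ex| + |ey| + addCost t U w * (y - x) with hC
  have hAw := addCost_nonneg t U hw2
  have hC0 : 0 ≤ C := by simp only [hC]; have := mul_nonneg hAw (sub_nonneg.2 hxy); positivity
  -- `e(w) ≤ a e(x) + b e(y) + C/(k+1)` for every `k`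
  have key : ∀ k : ℕ, energyDensity2D t U w ≤ a * ex + b * ey + C / (k + 1 : ℕ) := by
    intro k
    have hKpos : (0 : ℝ) < (k + 1 : ℕ) := by positivity
    set m : ℕ := ⌊b * (k + 1 : ℕ)⌋₊ with hm
    have hmle : (m : ℝ) ≤ b * (k + 1 : ℕ) := Nat.floor_le (by positivity)
    have hmlt : b * (k + 1 : ℕ) < m + 1 := Nat.lt_floor_add_one _
    have hmK : m ≤ k + 1 := by
      have : (m : ℝ) ≤ (k + 1 : ℕ) := hmle.trans (by nlinarith)
      exact_mod_cast this
    -- the rational point `z = ((K - m) x + m y)/K ≤ w`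
    set z : ℝ := (((k + 1 - m : ℕ) : ℝ) * x + ((k + 1 : ℕ) - ((k + 1 - m : ℕ) : ℝ)) * y) / (k + 1 : ℕ)
      with hz
    have hcast : ((k + 1 - m : ℕ) : ℝ) = (k + 1 : ℕ) - m := by push_cast [Nat.cast_sub hmK]; ring
    have hz' : z = x + (m / (k + 1 : ℕ)) * (y - x) := by
      simp only [hz, hcast]; field_simp; ring
    have hθ' : b - 1 / (k + 1 : ℕ) ≤ (m : ℝ) / (k + 1 : ℕ) := by
      have h : b ≤ ((m : ℝ) + 1) / (k + 1 : ℕ) := by rw [le_div_iff₀ hKpos]; linarith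
      rw [add_div] at h; linarith
    have hθ : (m : ℝ) / (k + 1 : ℕ) ≤ b := by rw [div_le_iff₀ hKpos]; exact hmle
    have ha' : a = 1 - b := by linarith
    have hdiff : a * x + b * y - (x + m / (k + 1 : ℕ) * (y - x)) = (b - m / (k + 1 : ℕ)) * (y - x) := by
      rw [ha']; ring
    have hzw : z ≤ w := by
      rw [hz', hw, ← sub_nonneg, hdiff]
      exact mul_nonneg (by linarith) (by linarith)
    have hwz : w - z ≤ (y - x) / (k + 1 : ℕ) := by
      rw [hz', hw, hdiff]
      calc (b - m / (k + 1 : ℕ)) * (y - x) ≤ (1 / (k + 1 : ℕ)) * (y - x) :=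
            mul_le_mul_of_nonneg_right (by linarith) (by linarith)
        _ = (y - x) / (k + 1 : ℕ) := by ring
    have hz0 : 0 ≤ z := by
      rw [hz']
      have := mul_nonneg (div_nonneg (Nat.cast_nonneg m) hKpos.le) (sub_nonneg.2 hxy)
      linarith
    -- rational convexity at `z`, then add density up to `w`
    have hrat := csp_energyDensity2D_ratConvex t U hx0 hx2 hy0 hy2 k (k + 1 - m) (Nat.sub_le _ _)
    rw [← hz] at hrat
    have hmono := csp_energyDensity2D_le_add t U hz0 hzw hw2
    have hcoef1 : ((k + 1 - m : ℕ) : ℝ) / (k + 1 : ℕ) = 1 - m / (k + 1 : ℕ) := by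
      rw [hcast]; field_simp
    have hcoef2 : (((k + 1 : ℕ) : ℝ) - ((k + 1 - m : ℕ) : ℝ)) / (k + 1 : ℕ) = m / (k + 1 : ℕ) := by
      rw [hcast]; ring_nf
    rw [hcoef1, hcoef2] at hrat
    -- `|(1 - m/K - a) ex + (m/K - b) ey| ≤ (|ex| + |ey|)/K`
    have hd1 : |(1 - (m : ℝ) / (k + 1 : ℕ) - a) * ex| ≤ |ex| / (k + 1 : ℕ) := by
      rw [abs_mul, div_eq_mul_one_div |ex|, mul_comm |ex|]
      refine mul_le_mul_of_nonneg_right ?_ (abs_nonneg _)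
      rw [abs_le]; constructor <;> linarith
    have hd2 : |((m : ℝ) / (k + 1 : ℕ) - b) * ey| ≤ |ey| / (k + 1 : ℕ) := by
      rw [abs_mul, div_eq_mul_one_div |ey|, mul_comm |ey|]
      refine mul_le_mul_of_nonneg_right ?_ (abs_nonneg _)
      rw [abs_le]; constructor <;> linarith
    have hd1' := le_abs_self ((1 - (m : ℝ) / (k + 1 : ℕ) - a) * ex)
    have hd2' := le_abs_self (((m : ℝ) / (k + 1 : ℕ) - b) * ey)
    have hd3 : addCost t U w * (w - z) ≤ addCost t U w * (y - x) / (k + 1 : ℕ) := by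
      rw [mul_div_assoc]; exact mul_le_mul_of_nonneg_left hwz hAw
    have hCK : C / (k + 1 : ℕ) = |ex| / (k + 1 : ℕ) + |ey| / (k + 1 : ℕ) +
        addCost t U w * (y - x) / (k + 1 : ℕ) := by
      simp only [hC]; rw [add_div, add_div]
    rw [hCK]
    nlinarith [hrat, hmono, hd1, hd2, hd1', hd2', hd3]
  -- let `k → ∞`
  refine le_of_forall_pos_le_add fun ε hε => ?_
  obtain ⟨k, hk⟩ := exists_nat_gt (C / ε)
  have hk' : C / (k + 1 : ℕ) ≤ ε := by
    rw [div_le_iff₀ (by positivity)]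
    rw [div_lt_iff₀ hε] at hk
    push_cast; nlinarith
  linarith [key k]

/-- **Main theorem — the canonical energy density of the 2D Hubbard torus for an interaction of
either sign.** For every hopping `t` and EVERY real `U`: (i) for every density `0 ≤ n < 2` the
canonical ground-state energy per site `E_{L×L}(2⌊nL²/2⌋)/L²` of the Hubbard torus `ℤ/Lℤ × ℤ/Lℤ`
converges to `energyDensity2D t U n`; (ii) `n ↦ energyDensity2D t U n` is convex on `[0, 2)` (the
tree's `tendsto_energyDensity2D` / `convexOn_energyDensity2D` assume `U ≥ 0`). [folklore] -/
theorem csp_energyDensity :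
    ∀ t U : ℝ,
      (∀ n : ℝ, 0 ≤ n → n < 2 → Filter.Tendsto (fun L : ℕ =>
        groundEnergyAt (fermionRectTorusGraph L L) t U (ThermodynamicLimit.rectN n L) / (L : ℝ) ^ 2)
          Filter.atTop (nhds (ThermodynamicLimit.energyDensity2D t U n))) ∧
      ConvexOn ℝ (Set.Ico (0 : ℝ) 2) (ThermodynamicLimit.energyDensity2D t U) :=
  fun t U => ⟨fun _ hn0 hn2 => csp_tendsto_energyDensity2D t U hn0 hn2,
    csp_convexOn_energyDensity2D t U⟩

end Summit.HubbardSuperconductivity.HubbardSuperconductivity.Theorems.CwSsbToEvenTorusLRO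

end
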